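import Summits.ValiantsHypothesis.ValiantsHypothesis.Theorems.KPlusLogSqLawTropicalBBasisExchange

/-!
# Route «KPlusLogSqLaw», crux `TropicalB` (stmt-ValiantsHypothesis-19771) — the CROSSED EXCHANGE of two near-perfect matchings
# (Jacobi / Dodgson uncrossing at the matching level): LYING pairs or CLOSING pair, with the same multiset of cells

HONEST FRAMING.  Helper toward the registered stubs `stub_tropThin` / `stub_tropFat` of `Cruxes/TropicalB/Lines/birth.lean` (crux
`Summit.ValiantsHypothesis.ValiantsHypothesis.Theses.KPlusLogSqLaw.TropicalB`, item stmt-ValiantsHypothesis-19771, route KPlusLogSqLaw;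
cell `pub-symmetroid`, seat val-sym-trop-p5 g15, refuter-adjacent lane, 2026-08-28; `--supports … --as helper`).  A COMBINATORIAL ENGINE
about matchings of an arbitrary bipartite graph, in the tree's vocabulary `Literature.Computability.MetaComplexity.PBij.IsPMatching` /
`dom` / `rng`, derived from val-sym-trop-p1's augmenting-path exchange `MatchingExchange.exchange` (…TropicalBMatchingExchange).  It bounds
nothing by itself and says nothing about `TropicalB` in its window, `WeakLifting`, DoorA26 / DoorA34, `MatrixDescartes`
(stmt-ValiantsHypothesis-18050) or VP ≠ VNP.

THE ENGINE (`CrossedExchange.crossed_exchange`).  Let `M₁`, `M₂` be matchings which are NEAR-PERFECT on `X × Y` with different holes: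
`dom M₁ = X − h₁`, `rng M₁ = Y − k₁`, `dom M₂ = X − h₂`, `rng M₂ = Y − k₂`, `h₁ ≠ h₂`, `k₁ ≠ k₂`.  Then there are matchings `N₁`, `N₂`
with THE SAME MULTISET OF CELLS (`N₁ ∪ N₂ = M₁ ∪ M₂`, `N₁ ∩ N₂ = M₁ ∩ M₂`, so every additive weight — slope or valuation — has
`w N₁ + w N₂ = w M₁ + w M₂`) and EITHER (LYING) `N₁` has holes `(h₁, k₂)` and `N₂` has holes `(h₂, k₁)`, OR (CLOSING) `N₁` is
perfect and `N₂` misses exactly the rows `h₁, h₂` and the columns `k₁, k₂` — the matching-level form of Jacobi's identity on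
complementary minors of the adjugate (tropically: `C(h₁,k₁) + C(h₂,k₂) ≥ min(C(h₁,k₂) + C(h₂,k₁), C(∅) + C(h₁h₂,k₁k₂))` for the
min-plus cofactors).  PROOF: let `(h₁, c)` be the edge of `M₂` at row `h₁`; if `c = k₁` move it (CLOSING); otherwise apply
`MatchingExchange.exchange` to `M₂ − (h₁,c)` and `M₁` and locate the two members by ROW/COLUMN DEGREE BOOKKEEPING
(`CrossedExchange.filter_card_add`: the multiset identity makes the degrees add up at every row and column); putting `(h₁,c)` back
into the member that misses `c` gives CLOSING or LYING.
WHY (architecture census, K = 4 «third digit»; companion of `…TropicalBTwoSignalLaw`, p624662): a register that shows a ROW hole to one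
neighbour and a COLUMN hole to another has, for any two states, configurations `M₁`, `M₂` as above; the engine manufactures the two
LYING configurations (or the CLOSED + DOUBLE-HOLE pair) at the same total cost and slope, which with `MultiExchange.prefix_deficit`
(t = 2) is the dominance-level constraint behind the seat's located LP certificates (memo TWO-SIGNAL-g15.md).
[folklore: Jacobi 1841 / Dodgson condensation, alternating-path uncrossing; derived from Berge's augmenting-path exchange]
-/

set_option linter.dupNamespace false
set_option autoImplicit false

namespace Summit.ValiantsHypothesis.ValiantsHypothesis.Theorems.KPlusLogSqLaw

namespace CrossedExchange
open Finset
open Literature.Computability.MetaComplexity.PBij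

variable {α β : Type*} [DecidableEq α] [DecidableEq β]

/-! ### Indicator arithmetic -/
/-- two indicators summing to `2`. [elementary] -/
theorem ind_two {P Q : Prop} [Decidable P] [Decidable Q]
    (h : (if P then 1 else 0) + (if Q then 1 else 0) = 2) : P ∧ Q := by
  by_cases p : P <;> by_cases q : Q <;> simp [p, q] at h ⊢

/-- two indicators summing to `0`. [elementary] -/
theorem ind_zero {P Q : Prop} [Decidable P] [Decidable Q]
    (h : (if P then 1 else 0) + (if Q then 1 else 0) = 0) : ¬P ∧ ¬Q := by
  by_cases p : P <;> by_cases q : Q <;> simp [p, q] at h ⊢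

/-- two indicators summing to `1`: the first holds iff the second fails. [elementary] -/
theorem ind_one {P Q : Prop} [Decidable P] [Decidable Q]
    (h : (if P then 1 else 0) + (if Q then 1 else 0) = 1) : (P ↔ ¬Q) := by
  by_cases p : P <;> by_cases q : Q <;> simp [p, q] at h ⊢

/-! ### Degree bookkeeping -/
/-- If two pairs of finsets have the same union and the same intersection, their filtered cardinalities add up equally
(the multiset identity read through any predicate). [folklore] -/
theorem filter_card_add {N₁ N₂ A B : Finset (α × β)} (hU : N₁ ∪ N₂ = A ∪ B) (hI : N₁ ∩ N₂ = A ∩ B)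
    (P : α × β → Prop) [DecidablePred P] :
    (N₁.filter P).card + (N₂.filter P).card = (A.filter P).card + (B.filter P).card := by
  have e₁ := Finset.card_union_add_card_inter (N₁.filter P) (N₂.filter P)
  have e₂ := Finset.card_union_add_card_inter (A.filter P) (B.filter P)
  rw [← Finset.filter_union, ← Finset.filter_inter_distrib, hU, hI, Finset.filter_union,
    Finset.filter_inter_distrib] at e₁
  omega

omit [DecidableEq β] in
/-- row degree of a matching: `1` on its domain, `0` elsewhere. [folklore] -/
theorem rowdeg_eq {S : Finset (α × β)} (hS : IsPMatching S) (r : α) :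
    (S.filter (fun p => p.1 = r)).card = if r ∈ dom S then 1 else 0 := by
  split_ifs with hr
  · obtain ⟨b, hb⟩ := mem_dom.1 hr
    rw [Finset.card_eq_one]
    refine ⟨(r, b), ?_⟩
    ext p
    simp only [Finset.mem_filter, Finset.mem_singleton]
    constructor
    · rintro ⟨hp, hpr⟩
      exact hS p hp (r, b) hb (Or.inl hpr)
    · rintro rfl; exact ⟨hb, rfl⟩
  · rw [Finset.card_eq_zero, Finset.filter_eq_empty_iff]
    intro p hp hpr
    exact hr (mem_dom.2 ⟨p.2, by rw [← hpr]; exact hp⟩)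

omit [DecidableEq α] in
/-- column degree of a matching: `1` on its range, `0` elsewhere. [folklore] -/
theorem coldeg_eq {S : Finset (α × β)} (hS : IsPMatching S) (k : β) :
    (S.filter (fun p => p.2 = k)).card = if k ∈ rng S then 1 else 0 := by
  split_ifs with hk
  · obtain ⟨a, ha⟩ := mem_rng.1 hk
    rw [Finset.card_eq_one]
    refine ⟨(a, k), ?_⟩
    ext p
    simp only [Finset.mem_filter, Finset.mem_singleton]
    constructor
    · rintro ⟨hp, hpk⟩
      exact hS p hp (a, k) ha (Or.inr hpk)
    · rintro rfl; exact ⟨ha, rfl⟩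
  · rw [Finset.card_eq_zero, Finset.filter_eq_empty_iff]
    intro p hp hpk
    exact hk (mem_rng.2 ⟨p.1, by rw [← hpk]; exact hp⟩)

/-- ROW BALANCE: under the multiset identity the row indicators of four matchings add up. [folklore] -/
theorem row_balance {N₁ N₂ A B : Finset (α × β)} (hN₁ : IsPMatching N₁) (hN₂ : IsPMatching N₂)
    (hA : IsPMatching A) (hB : IsPMatching B) (hU : N₁ ∪ N₂ = A ∪ B) (hI : N₁ ∩ N₂ = A ∩ B) (r : α) :
    (if r ∈ dom N₁ then 1 else 0) + (if r ∈ dom N₂ then 1 else 0)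
      = (if r ∈ dom A then 1 else 0) + (if r ∈ dom B then 1 else 0) := by
  have h := filter_card_add hU hI (fun p : α × β => p.1 = r)
  rw [rowdeg_eq hN₁, rowdeg_eq hN₂, rowdeg_eq hA, rowdeg_eq hB] at h
  exact h

/-- COLUMN BALANCE. [folklore] -/
theorem col_balance {N₁ N₂ A B : Finset (α × β)} (hN₁ : IsPMatching N₁) (hN₂ : IsPMatching N₂)
    (hA : IsPMatching A) (hB : IsPMatching B) (hU : N₁ ∪ N₂ = A ∪ B) (hI : N₁ ∩ N₂ = A ∩ B) (k : β) :
    (if k ∈ rng N₁ then 1 else 0) + (if k ∈ rng N₂ then 1 else 0)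
      = (if k ∈ rng A then 1 else 0) + (if k ∈ rng B then 1 else 0) := by
  have h := filter_card_add hU hI (fun p : α × β => p.2 = k)
  rw [coldeg_eq hN₁, coldeg_eq hN₂, coldeg_eq hA, coldeg_eq hB] at h
  exact h

/-! ### One-edge modifications (`MatchingExchange.dom_insert_eq` & co. are in …TropicalBBasisExchange) -/
/-- Moving an edge `e ∈ B`, `e ∉ A` from `B` to `A` preserves union and intersection. [folklore] -/
theorem union_inter_move {A B : Finset (α × β)} {e : α × β} (heB : e ∈ B) (heA : e ∉ A) :
    insert e A ∪ B.erase e = A ∪ B ∧ insert e A ∩ B.erase e = A ∩ B := by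
  constructor
  · rw [Finset.insert_union, ← Finset.union_insert, Finset.insert_erase heB]
  · rw [Finset.insert_inter_of_notMem (Finset.notMem_erase e B)]
    ext x
    simp only [Finset.mem_inter, Finset.mem_erase, ne_eq]
    constructor
    · rintro ⟨hx, -, hx'⟩; exact ⟨hx, hx'⟩
    · rintro ⟨hx, hx'⟩; exact ⟨hx, fun h => heA (h ▸ hx), hx'⟩

/-! ### The crossed exchange -/
/-- **CROSSED EXCHANGE (Jacobi uncrossing).**  Two near-perfect matchings on `X × Y` with different hole rows `h₁ ≠ h₂` and different
hole columns `k₁ ≠ k₂` can be re-split, keeping the multiset of cells, into the two LYING near-perfect matchings (holes `(h₁,k₂)` and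
`(h₂,k₁)`) or into a PERFECT matching and the DOUBLE-HOLE matching. [folklore: Jacobi / Dodgson; alternating-path uncrossing] -/
theorem crossed_exchange {X : Finset α} {Y : Finset β} {M₁ M₂ : Finset (α × β)}
    (h₁M : IsPMatching M₁) (h₂M : IsPMatching M₂) {h₁ h₂ : α} {k₁ k₂ : β}
    (hh₁ : h₁ ∈ X) (hh₂ : h₂ ∈ X) (hk₁ : k₁ ∈ Y) (hk₂ : k₂ ∈ Y) (hh : h₁ ≠ h₂) (hk : k₁ ≠ k₂)
    (hd₁ : dom M₁ = X.erase h₁) (hr₁ : rng M₁ = Y.erase k₁) (hd₂ : dom M₂ = X.erase h₂) (hr₂ : rng M₂ = Y.erase k₂) :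
    ∃ N₁ N₂ : Finset (α × β), IsPMatching N₁ ∧ IsPMatching N₂ ∧ N₁ ∪ N₂ = M₁ ∪ M₂ ∧ N₁ ∩ N₂ = M₁ ∩ M₂ ∧
      ((dom N₁ = X.erase h₁ ∧ rng N₁ = Y.erase k₂ ∧ dom N₂ = X.erase h₂ ∧ rng N₂ = Y.erase k₁) ∨
       (dom N₁ = X ∧ rng N₁ = Y ∧ dom N₂ = (X.erase h₁).erase h₂ ∧ rng N₂ = (Y.erase k₁).erase k₂)) := by
  -- cardinalities
  have hXY : X.card = Y.card := by
    have a := h₁M.card_dom; have b := h₁M.card_rng;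
    rw [hd₁, Finset.card_erase_of_mem hh₁] at a; rw [hr₁, Finset.card_erase_of_mem hk₁] at b
    have : 0 < X.card := Finset.card_pos.2 ⟨h₁, hh₁⟩
    have : 0 < Y.card := Finset.card_pos.2 ⟨k₁, hk₁⟩
    omega
  have hc₁ : M₁.card = X.card - 1 := by rw [← h₁M.card_dom, hd₁, Finset.card_erase_of_mem hh₁]
  have hc₂ : M₂.card = X.card - 1 := by rw [← h₂M.card_dom, hd₂, Finset.card_erase_of_mem hh₂]
  have hXpos : 2 ≤ X.card := by
    have hsub : ({h₁, h₂} : Finset α) ⊆ X := by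
      intro x hx; simp only [Finset.mem_insert, Finset.mem_singleton] at hx
      rcases hx with rfl | rfl <;> assumption
    have := Finset.card_le_card hsub
    rw [Finset.card_pair hh] at this; exact this
  -- the edge of `M₂` at the row `h₁`
  have hh₁d : h₁ ∈ dom M₂ := by rw [hd₂]; exact Finset.mem_erase.2 ⟨hh, hh₁⟩
  obtain ⟨c, hc⟩ := mem_dom.1 hh₁d
  have hcY : c ∈ Y.erase k₂ := by rw [← hr₂]; exact mem_rng.2 ⟨h₁, hc⟩
  have hcne₂ : c ≠ k₂ := (Finset.mem_erase.1 hcY).1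
  have hcY' : c ∈ Y := (Finset.mem_erase.1 hcY).2
  have hh₁M₁ : h₁ ∉ dom M₁ := by rw [hd₁]; exact Finset.notMem_erase h₁ X
  have hnot₁ : (h₁, c) ∉ M₁ := fun h => hh₁M₁ (mem_dom.2 ⟨c, h⟩)
  -- `M₂ = insert (h₁,c) M₂'`, hence the target union / intersection in terms of `M₂' := M₂ − (h₁,c)`
  set M₂' := M₂.erase (h₁, c) with hM₂'
  have hMU : insert (h₁, c) (M₂' ∪ M₁) = M₁ ∪ M₂ := by
    rw [← Finset.insert_union, hM₂', Finset.insert_erase hc, Finset.union_comm]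
  have hMI : M₂' ∩ M₁ = M₁ ∩ M₂ := by
    rw [Finset.inter_comm, hM₂', ← Finset.inter_insert_of_notMem hnot₁, Finset.insert_erase hc]
  have h₂M' : IsPMatching M₂' := h₂M.subset (Finset.erase_subset _ _)
  have hdM₂' : dom M₂' = (X.erase h₂).erase h₁ := by rw [hM₂', MatchingExchange.dom_erase_eq h₂M hc, hd₂]
  have hrM₂' : rng M₂' = (Y.erase k₂).erase c := by rw [hM₂', MatchingExchange.rng_erase_eq h₂M hc, hr₂]
  by_cases hck : c = k₁
  · -- CLOSING directly: move `(h₁, k₁)` from `M₂` to `M₁`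
    subst hck
    have hfc : c ∉ rng M₁ := by rw [hr₁]; exact Finset.notMem_erase c Y
    obtain ⟨hU, hI⟩ := union_inter_move hc hnot₁
    refine ⟨insert (h₁, c) M₁, M₂', h₁M.insert hh₁M₁ hfc, h₂M', hU, hI, Or.inr ⟨?_, ?_, ?_, ?_⟩⟩
    · rw [MatchingExchange.dom_insert_eq, hd₁, Finset.insert_erase hh₁]
    · rw [MatchingExchange.rng_insert_eq, hr₁, Finset.insert_erase hk₁]
    · rw [hdM₂', Finset.erase_right_comm]
    · rw [hrM₂', Finset.erase_right_comm]
  · -- `c ≠ k₁`: augment `M₂ − (h₁,c)` from `M₁`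
    have hc₂' : M₂'.card = X.card - 2 := by rw [hM₂', Finset.card_erase_of_mem hc, hc₂]; omega
    have hlt : M₂'.card < M₁.card := by rw [hc₂', hc₁]; omega
    obtain ⟨N₁, N₂, hN₁, hN₂, hU, hI, hcard, hdomsub, hrngsub⟩ := MatchingExchange.exchange h₂M' h₁M hlt
    have hN₁c : N₁.card = X.card - 1 := by rw [hcard, hc₂']; omega
    have hN₂c : N₂.card = X.card - 2 := by
      have e₁ := Finset.card_union_add_card_inter N₁ N₂
      have e₂ := Finset.card_union_add_card_inter M₂' M₁
      rw [hU, hI] at e₁; omega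
    -- membership descriptions of the inputs
    have mdM₂' : ∀ r, r ∈ dom M₂' ↔ r ≠ h₁ ∧ r ≠ h₂ ∧ r ∈ X := by
      intro r; rw [hdM₂', Finset.mem_erase, Finset.mem_erase]
    have mrM₂' : ∀ k, k ∈ rng M₂' ↔ k ≠ c ∧ k ≠ k₂ ∧ k ∈ Y := by
      intro k; rw [hrM₂', Finset.mem_erase, Finset.mem_erase]
    have mdM₁ : ∀ r, r ∈ dom M₁ ↔ r ≠ h₁ ∧ r ∈ X := by intro r; rw [hd₁, Finset.mem_erase]
    have mrM₁ : ∀ k, k ∈ rng M₁ ↔ k ≠ k₁ ∧ k ∈ Y := by intro k; rw [hr₁, Finset.mem_erase]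
    -- balances
    have RB := fun r => row_balance hN₁ hN₂ h₂M' h₁M hU hI r
    have CB := fun k => col_balance hN₁ hN₂ h₂M' h₁M hU hI k
    -- rows: `h₁` is covered by nobody, every other row of `X` by both, `h₂` by exactly one; rows outside `X` by nobody
    have row_h₁ : h₁ ∉ dom N₁ ∧ h₁ ∉ dom N₂ := by
      have := RB h₁
      rw [if_neg (fun h => ((mdM₂' h₁).1 h).1 rfl), if_neg (fun h => ((mdM₁ h₁).1 h).1 rfl)] at this
      exact ind_zero this
    have row_out : ∀ r, r ∉ X → r ∉ dom N₁ ∧ r ∉ dom N₂ := by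
      intro r hr
      have := RB r
      rw [if_neg (fun h => hr ((mdM₂' r).1 h).2.2), if_neg (fun h => hr ((mdM₁ r).1 h).2)] at this
      exact ind_zero this
    have row_gen : ∀ r, r ∈ X → r ≠ h₁ → r ≠ h₂ → r ∈ dom N₁ ∧ r ∈ dom N₂ := by
      intro r hrX hr₁ hr₂
      have := RB r
      rw [if_pos ((mdM₂' r).2 ⟨hr₁, hr₂, hrX⟩), if_pos ((mdM₁ r).2 ⟨hr₁, hrX⟩)] at this
      exact ind_two this
    have row_h₂ : h₂ ∈ dom N₁ ↔ h₂ ∉ dom N₂ := by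
      have := RB h₂
      rw [if_neg (fun h => ((mdM₂' h₂).1 h).2.1 rfl), if_pos ((mdM₁ h₂).2 ⟨hh.symm, hh₂⟩)] at this
      exact ind_one this
    -- `dom N₁ = X − h₁` by cardinality, hence `h₂ ∈ dom N₁`, `h₂ ∉ dom N₂`
    have hdN₁ : dom N₁ = X.erase h₁ := by
      apply Finset.eq_of_subset_of_card_le
      · intro r hr
        refine Finset.mem_erase.2 ⟨fun h => row_h₁.1 (h ▸ hr), ?_⟩
        by_contra hrX; exact (row_out r hrX).1 hr
      · rw [Finset.card_erase_of_mem hh₁, hN₁.card_dom, hN₁c]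
    have hh₂N₁ : h₂ ∈ dom N₁ := by rw [hdN₁]; exact Finset.mem_erase.2 ⟨hh.symm, hh₂⟩
    have hh₂N₂ : h₂ ∉ dom N₂ := row_h₂.1 hh₂N₁
    have hdN₂ : dom N₂ = (X.erase h₁).erase h₂ := by
      ext r
      rw [Finset.mem_erase, Finset.mem_erase]
      constructor
      · intro hr
        refine ⟨fun h => hh₂N₂ (h ▸ hr), fun h => row_h₁.2 (h ▸ hr), ?_⟩
        by_contra hrX; exact (row_out r hrX).2 hr
      · rintro ⟨hr₂, hr₁, hrX⟩
        exact (row_gen r hrX hr₁ hr₂).2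
    -- columns: `k₁` only in `N₁`; every column of `Y` other than `k₁, k₂, c` in both; `k₂`, `c` each in exactly one
    have hk₁N₁ : k₁ ∈ rng N₁ := hrngsub ((mrM₂' k₁).2 ⟨fun h => hck h.symm, hk, hk₁⟩)
    have hk₁N₂ : k₁ ∉ rng N₂ := by
      have := CB k₁
      rw [if_pos ((mrM₂' k₁).2 ⟨fun h => hck h.symm, hk, hk₁⟩), if_neg (fun h => ((mrM₁ k₁).1 h).1 rfl)] at this
      exact (ind_one this).1 hk₁N₁
    have col_out : ∀ k, k ∉ Y → k ∉ rng N₁ ∧ k ∉ rng N₂ := by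
      intro k hkY
      have := CB k
      rw [if_neg (fun h => hkY ((mrM₂' k).1 h).2.2), if_neg (fun h => hkY ((mrM₁ k).1 h).2)] at this
      exact ind_zero this
    have col_gen : ∀ k, k ∈ Y → k ≠ k₁ → k ≠ k₂ → k ≠ c → k ∈ rng N₁ ∧ k ∈ rng N₂ := by
      intro k hkY e₁ e₂ e₃
      have := CB k
      rw [if_pos ((mrM₂' k).2 ⟨e₃, e₂, hkY⟩), if_pos ((mrM₁ k).2 ⟨e₁, hkY⟩)] at this
      exact ind_two this
    have col_k₂ : k₂ ∈ rng N₁ ↔ k₂ ∉ rng N₂ := by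
      have := CB k₂
      rw [if_neg (fun h => ((mrM₂' k₂).1 h).2.1 rfl), if_pos ((mrM₁ k₂).2 ⟨fun h => hk h.symm, hk₂⟩)] at this
      exact ind_one this
    have col_c : c ∈ rng N₁ ↔ c ∉ rng N₂ := by
      have := CB c
      rw [if_neg (fun h => ((mrM₂' c).1 h).1 rfl), if_pos ((mrM₁ c).2 ⟨hck, hcY'⟩)] at this
      exact ind_one this
    have hcardrng : (rng N₁).card = Y.card - 1 := by rw [hN₁.card_rng, hN₁c, hXY]
    -- `N₁` cannot contain both `k₂` and `c` (its range would be all of `Y`), nor miss both (too small)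
    have not_both : ¬ (k₂ ∈ rng N₁ ∧ c ∈ rng N₁) := by
      rintro ⟨a, b⟩
      have hsub : Y ⊆ rng N₁ := by
        intro k hkY
        by_cases e₁ : k = k₁; · exact e₁ ▸ hk₁N₁
        by_cases e₂ : k = k₂; · exact e₂ ▸ a
        by_cases e₃ : k = c; · exact e₃ ▸ b
        exact (col_gen k hkY e₁ e₂ e₃).1
      have := Finset.card_le_card hsub
      rw [hcardrng] at this
      have : 0 < Y.card := Finset.card_pos.2 ⟨k₁, hk₁⟩
      omega
    have not_neither : k₂ ∈ rng N₁ ∨ c ∈ rng N₁ := by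
      by_contra hcon
      push Not at hcon
      have hsub : rng N₁ ⊆ (Y.erase k₂).erase c := by
        intro k hk'
        refine Finset.mem_erase.2 ⟨fun e => hcon.2 (e ▸ hk'), Finset.mem_erase.2 ⟨fun e => hcon.1 (e ▸ hk'), ?_⟩⟩
        by_contra hkY; exact (col_out k hkY).1 hk'
      have := Finset.card_le_card hsub
      rw [Finset.card_erase_of_mem (Finset.mem_erase.2 ⟨hcne₂, hcY'⟩), Finset.card_erase_of_mem hk₂, hcardrng] at this
      have : 2 ≤ Y.card := hXY ▸ hXpos
      omega
    -- the common union / intersection computations, for an edge put back into either member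
    have hU₂ : N₁ ∪ insert (h₁, c) N₂ = M₁ ∪ M₂ := by rw [Finset.union_insert, hU, hMU]
    have hU₁ : insert (h₁, c) N₁ ∪ N₂ = M₁ ∪ M₂ := by rw [Finset.insert_union, hU, hMU]
    have hnN₁ : (h₁, c) ∉ N₁ := fun h => row_h₁.1 (mem_dom.2 ⟨c, h⟩)
    have hnN₂ : (h₁, c) ∉ N₂ := fun h => row_h₁.2 (mem_dom.2 ⟨c, h⟩)
    have hI₂ : N₁ ∩ insert (h₁, c) N₂ = M₁ ∩ M₂ := by rw [Finset.inter_insert_of_notMem hnN₁, hI, hMI]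
    have hI₁ : insert (h₁, c) N₁ ∩ N₂ = M₁ ∩ M₂ := by rw [Finset.insert_inter_of_notMem hnN₂, hI, hMI]
    rcases not_neither with hk₂N₁ | hcN₁
    · -- `k₂ ∈ rng N₁`, so `c ∉ rng N₁`: put the edge into `N₁` (perfect); `N₂` is the double hole — CLOSING
      have hcN₁ : c ∉ rng N₁ := fun h => not_both ⟨hk₂N₁, h⟩
      have hcN₂ : c ∈ rng N₂ := by by_contra h; exact hcN₁ (col_c.2 h)
      have hk₂N₂ : k₂ ∉ rng N₂ := col_k₂.1 hk₂N₁
      refine ⟨insert (h₁, c) N₁, N₂, hN₁.insert row_h₁.1 hcN₁, hN₂, hU₁, hI₁, Or.inr ⟨?_, ?_, hdN₂, ?_⟩⟩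
      · rw [MatchingExchange.dom_insert_eq, hdN₁, Finset.insert_erase hh₁]
      · rw [MatchingExchange.rng_insert_eq]
        apply Finset.eq_of_subset_of_card_le
        · intro k hk'
          rcases Finset.mem_insert.1 hk' with rfl | hk'
          · exact hcY'
          · by_contra hkY; exact (col_out k hkY).1 hk'
        · rw [Finset.card_insert_of_notMem hcN₁, hcardrng]
          have : 0 < Y.card := Finset.card_pos.2 ⟨k₁, hk₁⟩
          omega
      · ext k
        rw [Finset.mem_erase, Finset.mem_erase]
        constructor
        · intro hk'
          refine ⟨fun e => hk₂N₂ (e ▸ hk'), fun e => hk₁N₂ (e ▸ hk'), ?_⟩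
          by_contra hkY; exact (col_out k hkY).2 hk'
        · rintro ⟨e₂, e₁, hkY⟩
          by_cases e₃ : k = c
          · exact e₃ ▸ hcN₂
          · exact (col_gen k hkY e₁ e₂ e₃).2
    · -- `c ∈ rng N₁`, so `k₂ ∉ rng N₁`: `N₁` is lying `(h₁,k₂)`; the edge goes into `N₂`, lying `(h₂,k₁)` — LYING
      have hk₂N₁ : k₂ ∉ rng N₁ := fun h => not_both ⟨h, hcN₁⟩
      have hk₂N₂ : k₂ ∈ rng N₂ := by by_contra h; exact hk₂N₁ (col_k₂.2 h)
      have hcN₂ : c ∉ rng N₂ := col_c.1 hcN₁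
      refine ⟨N₁, insert (h₁, c) N₂, hN₁, hN₂.insert row_h₁.2 hcN₂, hU₂, hI₂, Or.inl ⟨hdN₁, ?_, ?_, ?_⟩⟩
      · apply Finset.eq_of_subset_of_card_le
        · intro k hk'
          refine Finset.mem_erase.2 ⟨fun e => hk₂N₁ (e ▸ hk'), ?_⟩
          by_contra hkY; exact (col_out k hkY).1 hk'
        · rw [Finset.card_erase_of_mem hk₂, hcardrng]
      · rw [MatchingExchange.dom_insert_eq, hdN₂, Finset.erase_right_comm, Finset.insert_erase (Finset.mem_erase.2 ⟨hh, hh₁⟩)]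
      · rw [MatchingExchange.rng_insert_eq]
        ext k
        rw [Finset.mem_insert, Finset.mem_erase]
        constructor
        · rintro (rfl | hk')
          · exact ⟨hck, hcY'⟩
          · refine ⟨fun e => hk₁N₂ (e ▸ hk'), ?_⟩
            by_contra hkY; exact (col_out k hkY).2 hk'
        · rintro ⟨e₁, hkY⟩
          by_cases e₃ : k = c
          · exact Or.inl e₃
          by_cases e₂ : k = k₂
          · exact Or.inr (e₂ ▸ hk₂N₂)
          · exact Or.inr (col_gen k hkY e₁ e₂ e₃).2

end CrossedExchange

end Summit.ValiantsHypothesis.ValiantsHypothesis.Theorems.KPlusLogSqLaw
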